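import Summits.Parity.GeneralizedHardyLittlewood.Theses.GoldbachHeathBrownDispersion
import HarnessLib

/-!
# Route `GoldbachHeathBrownDispersion` — glue item `HeathBrownMorozUniformOfSplit` (stmt-Parity-20704)

Glue of the split (gen 1) of the crux `HeathBrownMorozUniform` (stmt-Parity-19915) of route
`route-Parity-GoldbachHeathBrownDispersion` (Line C, rung F-P1b):

  `RangeKernelReduced → ShiftInvariance → HeathBrownMorozUniform`.

Given `Q`, take the box exponent `c_Q = 1 + ∑ c₁(d, a, b)` over the finitely many reduced classes
`(a, b) mod d` with `d ≤ Q` (the thresholds `c₁` of `RangeKernelReduced`, extended by a dummy value off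
the admissible reduced classes), reduce an arbitrary admissible `(a, b)` to `(a % d, b % d)` through
`ShiftInvariance`, and merge the singular series `σ₀` by uniqueness of the limit of
`singularProductPartial`.  The proof is the planner's attached, farm-checked `children_check.lean`
(`heathBrownMorozUniform_of_split`, sha16 106f55c9b603f8b6, evidence on stmt-Parity-20704), moved to the
`Theorems` namespace (route-file-only imports, so the file sits outside the Theorems cone of the
Reduction module).

(Remark: child `RangeKernelReduced` is also, verbatim, the hypothesis of the landed finite-max theorem
`…GoldbachHeathBrownDispersionHeathBrownMorozUniform.heathBrownMorozUniform_of_allLargeC`, which gives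
the parent from the first child alone; the proof below follows the split's stated design and uses the
second child for the reduction step.)

References: D. R. Heath-Brown, B. Z. Moroz, Proc. London Math. Soc. 88 (2004), Theorem 2
[HeathBrownMoroz2004]; D. R. Heath-Brown, Acta Math. 186 (2001) [HeathBrownActa2001].
-/

namespace Summit.Parity.GeneralizedHardyLittlewood.Theorems

open Filter Asymptotics Finset
open Summit.Parity.GeneralizedHardyLittlewood.Theses.GoldbachHeathBrownDispersion

/-- `(a % d)³ + 2 (b % d)³` is coprime to `d` as soon as `a³ + 2 b³` is (the two are congruent
mod `d`). [folklore] -/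
theorem goldbachHeathBrownDispersion_coprime_cubicForm_mod {d a b : ℕ}
    (h : Nat.Coprime (a ^ 3 + 2 * b ^ 3) d) : Nat.Coprime ((a % d) ^ 3 + 2 * (b % d) ^ 3) d := by
  have hmod : (a % d) ^ 3 + 2 * (b % d) ^ 3 ≡ a ^ 3 + 2 * b ^ 3 [MOD d] :=
    ((Nat.mod_modEq a d).pow 3).add (((Nat.mod_modEq b d).pow 3).mul_left 2)
  rw [Nat.Coprime, hmod.gcd_eq]
  exact h

/-- **`HeathBrownMorozUniformOfSplit` holds** (route `GoldbachHeathBrownDispersion`, glue stmt-Parity-20704):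
`RangeKernelReduced → ShiftInvariance → HeathBrownMorozUniform` — finite max of the class thresholds
`c₁(d, a, b)` over the reduced admissible classes with `d ≤ Q` (`c_Q = 1 + ∑ c₁`), `σ₀` merged by
uniqueness of the limit of `singularProductPartial`, an arbitrary admissible `(a, b)` reduced to
`(a % d, b % d)` by `ShiftInvariance`. [cite: HeathBrownMoroz2004, Theorem 2] -/
theorem goldbachHeathBrownDispersion_heathBrownMorozUniformOfSplit_proof :
    Summit.Parity.GeneralizedHardyLittlewood.Theses.GoldbachHeathBrownDispersion.HeathBrownMorozUniformOfSplit := by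
  unfold Summit.Parity.GeneralizedHardyLittlewood.Theses.GoldbachHeathBrownDispersion.HeathBrownMorozUniformOfSplit
  intro h1 h2
  unfold Summit.Parity.GeneralizedHardyLittlewood.Theses.GoldbachHeathBrownDispersion.HeathBrownMorozUniform
  classical
  intro Q
  -- thresholds, extended by a dummy value outside the admissible reduced classes
  have hc0 : ∀ t : ℕ × ℕ × ℕ, ∃ c₁ : ℝ, 0 < c₁ ∧ (0 < t.1 → t.2.1 < t.1 → t.2.2 < t.1 →
      Nat.Coprime (t.2.1 ^ 3 + 2 * t.2.2 ^ 3) t.1 → ∀ c : ℝ, c₁ ≤ c → ∃ σ₀ : ℝ, 0 < σ₀ ∧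
        Filter.Tendsto Literature.NumberTheory.Sieve.CubicPrimes.singularProductPartial
          Filter.atTop (nhds σ₀) ∧ Asymptotics.IsLittleO Filter.atTop
          (fun X : ℝ => (Literature.NumberTheory.Sieve.CubicPrimes.residueClassPrimeCount X
              (Real.log X ^ (-c)) t.1 t.2.1 t.2.2 : ℝ) -
            Literature.NumberTheory.Sieve.CubicPrimes.classWeight t.1 *
              Literature.NumberTheory.Sieve.CubicPrimes.mainTerm c σ₀ X)
          (fun X : ℝ => Literature.NumberTheory.Sieve.CubicPrimes.mainTerm c σ₀ X)) := by
    intro t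
    by_cases h : 0 < t.1 ∧ t.2.1 < t.1 ∧ t.2.2 < t.1 ∧ Nat.Coprime (t.2.1 ^ 3 + 2 * t.2.2 ^ 3) t.1
    · obtain ⟨c₁, hc₁, rest⟩ := h1 t.1 t.2.1 t.2.2 h.1 h.2.1 h.2.2.1 h.2.2.2
      exact ⟨c₁, hc₁, fun _ _ _ _ => rest⟩
    · exact ⟨1, one_pos, fun h₁ h₂ h₃ h₄ => (h ⟨h₁, h₂, h₃, h₄⟩).elim⟩
  choose c₁ hc₁pos hc₁ using hc0
  -- the singular series from the trivial class at its own threshold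
  obtain ⟨c', hc', h100⟩ := h1 1 0 0 one_pos one_pos one_pos (Nat.coprime_one_right _)
  obtain ⟨σ₀, hσ₀, hT, -⟩ := h100 c' le_rfl
  -- the finite index set of reduced classes with modulus ≤ Q
  set T : Finset (ℕ × ℕ × ℕ) := Finset.Icc 1 Q ×ˢ (Finset.range Q ×ˢ Finset.range Q) with hTdef
  refine ⟨1 + ∑ t ∈ T, c₁ t, add_pos_of_pos_of_nonneg one_pos
    (Finset.sum_nonneg fun t _ => (hc₁pos t).le), σ₀, hσ₀, hT, ?_⟩
  intro d a b hd hdQ hcop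
  set c : ℝ := 1 + ∑ t ∈ T, c₁ t with hcdef
  have hcpos : 0 < c := add_pos_of_pos_of_nonneg one_pos (Finset.sum_nonneg fun t _ => (hc₁pos t).le)
  have ha' : a % d < d := Nat.mod_lt _ hd
  have hb' : b % d < d := Nat.mod_lt _ hd
  have hcop' : Nat.Coprime ((a % d) ^ 3 + 2 * (b % d) ^ 3) d :=
    goldbachHeathBrownDispersion_coprime_cubicForm_mod hcop
  have ht : (d, a % d, b % d) ∈ T := by
    simp only [hTdef, Finset.mem_product, Finset.mem_Icc, Finset.mem_range]
    exact ⟨⟨hd, hdQ⟩, lt_of_lt_of_le ha' hdQ, lt_of_lt_of_le hb' hdQ⟩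
  have hle : c₁ (d, a % d, b % d) ≤ c := by
    have := Finset.single_le_sum (f := c₁) (fun t _ => (hc₁pos t).le) ht
    linarith
  obtain ⟨σ₁, -, hT₁, hmain⟩ := hc₁ (d, a % d, b % d) hd ha' hb' hcop' c hle
  have hσ : σ₁ = σ₀ := tendsto_nhds_unique hT₁ hT
  rw [hσ] at hmain
  have hshift := h2 c σ₀ hcpos hσ₀ d (a % d) (b % d) (a / d) (b / d) hd
  rw [Nat.mod_add_div a d, Nat.mod_add_div b d] at hshift
  exact (hshift.add hmain).congr (fun X => by ring) (fun X => rfl)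

end Summit.Parity.GeneralizedHardyLittlewood.Theorems
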